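import Literature.NumberTheory.EllipticCurves.SkinnerUrban2014.CharacteristicIdealBaseChangeProofs
import Mathlib.LinearAlgebra.Matrix.Adjugate
import HarnessLib

/-!
# The characteristic ideal of a square presentation: `char(coker P) = (det P)`

B2B cell `bsd-rank1-residual`, unit `eisenstein-p1` GEN 17, FILE 12 (X1R0-GAPMAP §26.2b;
`V76-LOCAL-TERM-PLAN.md` §3.1, the first brick of (M3-n) = LEMMA M at layer `n`). HONEST FRAMING:
research route; THEOREMS ONLY (no `def`, no named fact); nothing booked.

Over a Noetherian unique factorisation domain `R` (e.g. `Λ = ℤ_p⟦T⟧`):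

* `charIdeal_eq_span_of_fittingIdeal_zero_eq_span`: if the zeroth Fitting ideal of a finite
  torsion module is PRINCIPAL, `Fitt₀(M) = (d)`, then `char(M) = (d)` — the tree's two
  Skinner–Urban §3.1.6 inclusions `Fitt₀ ⊆ char` and "a principal ideal containing `Fitt₀`
  contains `char`" squeeze.
* `det_smul_mem_span_range`, `isTorsion_coker_of_det_ne_zero`: `det P` kills `coker P`
  (adjugate), so `coker P` is torsion when `det P ≠ 0`.
* `fittingIdeal_zero_coker_eq_span_det`: `Fitt₀(coker P) = (det P)` (the tree's Stacks 07Z6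
  lemma `Module.fittingIdeal_zero_eq_span_det_of_square_presentation` applied to the standard
  basis).
* **`charIdeal_coker_eq_span_det`: `char(R^g / (rows of P)) = (det P)` for every square matrix
  `P` with `det P ≠ 0`.** This is the device by which `char_{Λ_n}(Λ/(f)) = (N_n f)` will be read
  off the matrix of multiplication by `f` on a `Λ_n`-basis of `Λ` (V87).

## Sources
* C. Skinner, E. Urban, Invent. Math. 195 (2014), §3.1.6 — tree
  `SkinnerUrban2014/CharacteristicIdealBaseChangeProofs.lean`.
* The Stacks Project, Tag 07Z6; D. Eisenbud, GTM 150, §20.2 — tree `Literature/RingTheory/FittingIdeal/`.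
-/

namespace Summit.BirchSwinnertonDyer.Rank1Residual.X1.CharIdealSquarePresentation

open Literature.RingTheory.FittingIdeal Literature.NumberTheory.EllipticCurves

universe u v

variable {R : Type u} [CommRing R]

/-! ## §1. Principal `Fitt₀` determines `char` -/

/-- **`Fitt₀(M) = (d) ⇒ char(M) = (d)`** for a finite torsion module over a Noetherian UFD.
[cite: SkinnerUrban2014, §3.1.6 (p. 20)] -/
theorem charIdeal_eq_span_of_fittingIdeal_zero_eq_span [IsNoetherianRing R] [IsDomain R]
    [UniqueFactorizationMonoid R] {M : Type v} [AddCommGroup M] [Module R M] [Module.Finite R M]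
    (hM : Module.IsTorsion R M) {d : R} (hd : Module.fittingIdeal R M 0 = Ideal.span {d}) :
    Module.charIdeal R M = Ideal.span {d} :=
  le_antisymm (SkinnerUrban2014.charIdeal_le_span_singleton_of_fittingIdeal_zero_le hM hd.le)
    (hd.ge.trans SkinnerUrban2014.fittingIdeal_zero_le_charIdeal)

/-! ## §2. The cokernel of a square matrix -/

section Coker

variable {g : ℕ} (P : Matrix (Fin g) (Fin g) R)

/-- `det P · v` lies in the row space of `P` for every `v ∈ R^g` (`adj P · P = det P · 1`).
[folklore] -/
theorem det_smul_mem_span_range (v : Fin g → R) :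
    P.det • v ∈ Submodule.span R (Set.range P) := by
  classical
  -- `det P • v = ∑_l v_l • (row l of adj P * P) = ∑_l v_l • ∑_t adj_{l t} • P t`
  have hrow : ∀ l : Fin g, P.det • (Pi.single l 1 : Fin g → R) = ∑ t, P.adjugate l t • P t := by
    intro l
    have h := congr_fun (congr_fun (Matrix.adjugate_mul P) l)
    ext j
    have hj := h j
    rw [Matrix.mul_apply, Matrix.smul_apply, Matrix.one_apply, smul_eq_mul] at hj
    simp only [Pi.smul_apply, Finset.sum_apply, smul_eq_mul, Pi.single_apply]
    rw [hj]
    by_cases hlj : l = j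
    · subst hlj; simp
    · simp [hlj, Ne.symm hlj]
  rw [pi_eq_sum_univ' v, Finset.smul_sum]
  refine Submodule.sum_mem _ fun l _ => ?_
  rw [smul_comm, hrow, Finset.smul_sum]
  refine Submodule.sum_mem _ fun t _ => ?_
  rw [smul_comm]
  exact Submodule.smul_mem _ _ (Submodule.smul_mem _ _ (Submodule.subset_span ⟨t, rfl⟩))

/-- `coker P = R^g / (rows of P)` is a torsion module when `det P ≠ 0` (`R` a domain). [folklore] -/
theorem isTorsion_coker_of_det_ne_zero [IsDomain R] (hP : P.det ≠ 0) :
    Module.IsTorsion R ((Fin g → R) ⧸ Submodule.span R (Set.range P)) := by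
  intro m
  obtain ⟨v, rfl⟩ := Submodule.mkQ_surjective _ m
  refine ⟨⟨P.det, mem_nonZeroDivisors_of_ne_zero hP⟩, ?_⟩
  rw [Submonoid.smul_def, ← map_smul, Submodule.mkQ_apply, Submodule.Quotient.mk_eq_zero]
  exact det_smul_mem_span_range P v

/-- **`Fitt₀(coker P) = (det P)`** for a square matrix `P` (generators: the images of the
standard basis; relations: the rows of `P`, which generate all relations).
[cite: StacksProject, Tag 07Z6] -/
theorem fittingIdeal_zero_coker_eq_span_det :
    Module.fittingIdeal R ((Fin g → R) ⧸ Submodule.span R (Set.range P)) 0 =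
      Ideal.span {P.det} := by
  classical
  set N := Submodule.span R (Set.range P) with hN
  let x : Fin g → (Fin g → R) ⧸ N := fun i => N.mkQ (Pi.single i 1)
  have hcomb : ∀ c : Fin g → R, ∑ l, c l • x l = N.mkQ c := fun c => by
    simp only [x, ← map_smul, ← map_sum]
    rw [← pi_eq_sum_univ' c]
  have hx : Submodule.span R (Set.range x) = ⊤ := by
    rw [eq_top_iff]
    rintro m -
    obtain ⟨c, rfl⟩ := N.mkQ_surjective m
    rw [← hcomb]
    exact Submodule.sum_mem _ fun l _ => Submodule.smul_mem _ _ (Submodule.subset_span ⟨l, rfl⟩)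
  have hP : ∀ t, ∑ l, P t l • x l = 0 := fun t => by
    rw [hcomb, Submodule.mkQ_apply, Submodule.Quotient.mk_eq_zero]
    exact Submodule.subset_span ⟨t, rfl⟩
  have hgen : ∀ ρ : Fin g → R, ∑ l, ρ l • x l = 0 → ρ ∈ Submodule.span R (Set.range P) :=
    fun ρ hρ => by
    rwa [hcomb, Submodule.mkQ_apply, Submodule.Quotient.mk_eq_zero] at hρ
  exact Module.fittingIdeal_zero_eq_span_det_of_square_presentation x hx P hP hgen

/-- **`char(coker P) = (det P)`** for a square matrix `P` with `det P ≠ 0` over a Noetherian UFD.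
[cite: SkinnerUrban2014, §3.1.6 (p. 20)] -/
theorem charIdeal_coker_eq_span_det [IsNoetherianRing R] [IsDomain R]
    [UniqueFactorizationMonoid R] (hP : P.det ≠ 0) :
    Module.charIdeal R ((Fin g → R) ⧸ Submodule.span R (Set.range P)) = Ideal.span {P.det} :=
  charIdeal_eq_span_of_fittingIdeal_zero_eq_span (isTorsion_coker_of_det_ne_zero P hP)
    (fittingIdeal_zero_coker_eq_span_det P)

end Coker

/-! ## §3. Over `Λ = ℤ_p⟦T⟧` -/

/-- `char_Λ(Λ^g / (rows of P)) = (det P)` for a square matrix `P` over the Iwasawa algebra with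
`det P ≠ 0`. [cite: SkinnerUrban2014, §3.1.6 (p. 20)] -/
theorem charIdeal_coker_eq_span_det_iwasawa {p : ℕ} [Fact p.Prime] {g : ℕ}
    (P : Matrix (Fin g) (Fin g) (IwasawaAlgebra p)) (hP : P.det ≠ 0) :
    Module.charIdeal (IwasawaAlgebra p)
        ((Fin g → IwasawaAlgebra p) ⧸ Submodule.span (IwasawaAlgebra p) (Set.range P)) =
      Ideal.span {P.det} :=
  charIdeal_coker_eq_span_det P hP

end Summit.BirchSwinnertonDyer.Rank1Residual.X1.CharIdealSquarePresentation
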